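import Summits.QuantumAdvantage.QuantumAdvantage.Theses.SpinorFlattening
import Summits.QuantumAdvantage.QuantumAdvantage.Theorems.SpinorFlatteningNegApproxGaussRankSuperpoly
import Literature.Computability.QuantumComplexity.GaussianRank

/-!
# Crux `SpinorFlattening.FlatteningBoundRobust` (stmt-QuantumAdvantage-1246) — PROOF

THE FLATTENING BOUND, robust form (route `SpinorFlattening`, crux rank 3):

  `∀ t K r, r · D_K(4t) < C(t,K) · 8^K →
     ∀ (a : Fin r → ℂ) (g : Fin r → QReg (4t) → ℂ), (∀ i, IsGaussian (g i)) →
       1 ≤ C(8t,K) · normSq (M^{⊗t} − Σ i, a i • g i)`,      `D_K(N) = Σ_{j ≤ K, j ≡ K (2)} C(N,j)`.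

Lead prover (line `isometric-subflattening-deficit`, merged by the triage panel with `mass-bound-corollary` and
`isometric-subflattening-bessel` — one lever): the crux is a COROLLARY of the sibling kill-crux
`NegApproxGaussRankSuperpoly` (stmt-QuantumAdvantage-1245), whose landed composition file
`Theorems/SpinorFlatteningNegApproxGaussRankSuperpoly.lean` exports the two analytic inputs BY NAME:

| part | statement | tree theorem (imported) |
|---|---|---|
| K1 deficiency | one subspace `W`, `dim W ≤ r·D_K(n)`, holds every degree-`K` Majorana-word image of `Σ aᵢ gᵢ` | `deficiency` (from `stub_normalOrder` + `stub_filterCard`) |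
| K2 fullness | the one-Majorana-per-block images of `|M⟩^{⊗t}` are orthonormal | `flatOrthonormal` (from `stub_flatOrthoOfInvariant` + `stub_magicInvariant`) |
| P1 mass bound | `|ι| − dim W ≤ |ι|·‖ψ − φ‖²` for a unitary family with orthonormal images of `ψ`, images of `φ` in `W` | `stub_massBound` |
| P2 family count | `C(t,K)·8^K ≤ |𝔉_K|` | `countGap_choose_mul_pow_le_card` |
| P3 binomial comparison | `C(t,K)·8^K ≤ C(8t,K)` | `robust_choose_mul_eight_pow_le` — proved here |

## The argument (Bessel mass bound on the isometric one-per-block sub-flattening)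
Fix `t, K`; `𝔉_K` = block patterns `s : Fin t → Option (Fin 4 × Bool)` exciting exactly `K` of the `t` four-qubit
blocks, each by ONE Jordan–Wigner Majorana; `mono s` = the ordered product (increasing blocks), a unitary.  For
`φ = Σ_{i<r} aᵢ gᵢ` with Gaussian `gᵢ`: K1 gives `W ∋ mono s · φ` for all `s`, `dim W ≤ r·D_K(4t)`; K2 says
`(mono s · M^{⊗t})_{s ∈ 𝔉_K}` is orthonormal; P1 gives `|𝔉_K| − dim W ≤ |𝔉_K|·‖M^{⊗t} − φ‖²`, which DESCENDS
along `R := C(t,K)·8^K ≤ |𝔉_K|` (P2) to the SHARP form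
  `flatteningBoundBessel : R − r·D_K(4t) ≤ R·‖M^{⊗t} − φ‖²`   (all `t K r`, no count hypothesis; attained at
  `(t,K,r) = (1,1,1)`: `‖M − a g‖² ≥ 1/2`, the Gaussian infidelity of `|M⟩`);
the crux's STRICT count `r·D_K(4t) < R` makes the left side `≥ 1`, and `R ≤ C(8t,K)` (P3) trades the family size
for the binomial factor of the crux (`FlatteningBoundRobust_of`).  By-product: the `δ = 0` support item
`FlatteningBoundExact` (stmt-QuantumAdvantage-1249) read off the crux (`FlatteningBoundExact_of`).

## Disproof.lean (crux workfile, gen 2) honoured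
`flatteningBoundRobust_iff` (the inline `maj/IsGauss/Mpow` lets ARE `majorana/IsGaussian/magicMPow`, definitionally —
`FlatteningBoundRobust_of` is accepted by `exact` on the named form); `_false_without_count` / `_false_with_le` (the
strict count is consumed exactly once, as `r·D + 1 ≤ R`); `_false_without_gauss` / `_false_without_linIndep` /
`_false_with_deficiency_pred` / `_false_with_four_fewer_annihilators` (Gaussianity with `n` independent annihilators
enters only through `deficiency`, with constant exactly `D_K`); §C/§H tightness (the sharp form is attained at
`(1,1,1)`; the factor `C(8t,K)` and the constant `1` are kept); §F `choose_mul_eight_pow_le` (same inequality as P3).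
-/

set_option linter.dupNamespace false -- D-0017: single-conjunct summit ⇒ `QuantumAdvantage.QuantumAdvantage` by design

noncomputable section

namespace Summit.QuantumAdvantage.QuantumAdvantage.Theorems.SpinorFlattening

open Matrix Finset
open Literature.Computability.QuantumComplexity Literature.Computability.Cryptography

/-! ## P3 — the binomial comparison `C(t,K)·8^K ≤ C(8t,K)` -/

/-- Iterated Pascal: `C(n, K+1) + m·C(n, K) ≤ C(n+m, K+1)`. [folklore] -/
theorem robust_choose_succ_add_mul_le (n K m : ℕ) :
    n.choose (K + 1) + m * n.choose K ≤ (n + m).choose (K + 1) := by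
  induction m with
  | zero => simp
  | succ m ih =>
    have hmono : n.choose K ≤ (n + m).choose K := Nat.choose_le_choose K (Nat.le_add_right n m)
    have hP : (n + (m + 1)).choose (K + 1) = (n + m).choose K + (n + m).choose (K + 1) := by
      rw [← Nat.add_assoc, Nat.choose_succ_succ']
    rw [hP]
    nlinarith [ih, hmono]

/-- `C(t,K)·8^K ≤ C(8t,K)`: choosing `K` of `t` blocks and one of `8` Majoranas in each is an injection into the
`K`-subsets of all `8t` Majorana labels (proved arithmetically by induction on `t` with Pascal's rule). [folklore] -/
theorem robust_choose_mul_eight_pow_le (t K : ℕ) : t.choose K * 8 ^ K ≤ (t * 8).choose K := by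
  induction t generalizing K with
  | zero => cases K <;> simp
  | succ t ih =>
    cases K with
    | zero => simp
    | succ K =>
      have ih0 := ih K
      have ih1 : t.choose (K + 1) * (8 ^ K * 8) ≤ (t * 8).choose (K + 1) := by
        rw [← pow_succ]; exact ih (K + 1)
      have hA := robust_choose_succ_add_mul_le (t * 8) K 8
      have hmul : (t + 1) * 8 = t * 8 + 8 := by ring
      rw [hmul, Nat.choose_succ_succ', pow_succ]
      have hsplit : (t.choose K + t.choose (K + 1)) * (8 ^ K * 8) =
          8 * (t.choose K * 8 ^ K) + t.choose (K + 1) * (8 ^ K * 8) := by ring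
      rw [hsplit]
      calc 8 * (t.choose K * 8 ^ K) + t.choose (K + 1) * (8 ^ K * 8)
          ≤ 8 * (t * 8).choose K + (t * 8).choose (K + 1) :=
            Nat.add_le_add (Nat.mul_le_mul_left 8 ih0) ih1
        _ ≤ (t * 8 + 8).choose (K + 1) := by linarith [hA]

/-! ## The composition over the part STATEMENTS (K1, K2, P1, P2 by `type_of%` of the landed theorems) -/

/-- Mass-bound DESCENT (real bookkeeping): `N − d ≤ N·x` and `R ≤ N` give `R − d ≤ R·x` (split on `x ≥ 1`). [folklore] -/
theorem robust_descent {N R d : ℕ} {x : ℝ} (hRN : R ≤ N)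
    (h : (N : ℝ) - d ≤ N * x) : (R : ℝ) - d ≤ R * x := by
  have hRN' : (R : ℝ) ≤ N := by exact_mod_cast hRN
  have hd : (0 : ℝ) ≤ d := Nat.cast_nonneg d
  by_cases hx1 : 1 ≤ x
  · nlinarith
  · rw [not_le] at hx1
    nlinarith

/-- **The sharp (mass-bound) form from the four part statements** — deficiency (K1), fullness (K2), the Bessel
mass bound (P1) and the lower family count (P2):
`C(t,K)·8^K − r·D_K(4t) ≤ C(t,K)·8^K · ‖M^{⊗t} − Σ aᵢ gᵢ‖²` for Gaussian `gᵢ`, with NO count hypothesis. -/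
theorem flatteningBoundBessel_of_parts (hD : type_of% deficiency) (hO : type_of% flatOrthonormal)
    (hB : type_of% stub_massBound) (hcard : type_of% countGap_choose_mul_pow_le_card) :
    ∀ (t K r : ℕ) (a : Fin r → ℂ) (g : Fin r → QReg (t * 4) → ℂ), (∀ i, IsGaussian (g i)) →
      ((t.choose K * 8 ^ K : ℕ) : ℝ) - ((r * flatteningDeficiency K (t * 4) : ℕ) : ℝ)
        ≤ ((t.choose K * 8 ^ K : ℕ) : ℝ) * normSq (magicMPow t - ∑ i, a i • g i) := by
  classical
  intro t K r a g hg
  -- the flat family: labels, monomials, index type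
  let lab : (Fin t → Option (Fin 4 × Bool)) → List (Fin (t * 4) × Bool) := fun s =>
    (List.finRange t).filterMap fun b => (s b).map fun q => (finProdFinEquiv (b, q.1), q.2)
  let mono : (Fin t → Option (Fin 4 × Bool)) → Matrix (QReg (t * 4)) (QReg (t * 4)) ℂ := fun s =>
    ((List.finRange t).filterMap fun b =>
      (s b).map fun q => majorana (t * 4) (finProdFinEquiv (b, q.1)) q.2).prod
  have hmono_lab : ∀ s, mono s = ((lab s).map fun p => majorana (t * 4) p.1 p.2).prod := by
    intro s
    simp only [mono, lab, List.map_filterMap, Option.map_map]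
    rfl
  let ι : Type := {s : Fin t → Option (Fin 4 × Bool) // (univ.filter fun b => (s b).isSome).card = K}
  -- K1 deficiency: one subspace W of dimension ≤ r·D_K(4t) holds every degree-K monomial image of φ
  obtain ⟨W, hW, hmem⟩ := hD (t * 4) K r a g hg
  -- unitarity of the monomials
  have hunit : ∀ s, mono s ∈ Matrix.unitaryGroup (QReg (t * 4)) ℂ := by
    intro s
    rw [hmono_lab]
    refine list_prod_mem ?_
    intro x hx
    obtain ⟨p, -, rfl⟩ := List.mem_map.1 hx
    exact majorana_mem_unitaryGroup _ _ _
  -- K2 fullness: orthonormality of the images of M^{⊗t}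
  obtain ⟨hO1, hO2⟩ := hO t mono (fun s => rfl)
  -- P1 mass bound for the degree-K family
  have hmass := hB (t * 4) ι (fun s => mono s.1) (magicMPow t) (∑ i, a i • g i) W
    (fun s => hunit s.1) (fun s => hO1 s.1)
    (fun s s' hss' => hO2 s.1 s'.1 fun h => hss' (Subtype.ext h))
    (fun s => by
      show mono s.1 *ᵥ _ ∈ W
      rw [hmono_lab]
      exact hmem (lab s.1) ((length_filterMap_labels t s.1).trans s.2))
  -- P2 lower count and the descent
  have hR : t.choose K * 8 ^ K ≤ Fintype.card ι := by convert hcard t K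
  have hdesc := robust_descent hR hmass
  have hWR : (Module.finrank ℂ W : ℝ) ≤ ((r * flatteningDeficiency K (t * 4) : ℕ) : ℝ) := by
    exact_mod_cast hW
  linarith

/-- **The crux over the named API from the sharp form and P3**: the count `r·D_K(4t) < C(t,K)·8^K` makes the left
side of the sharp form at least `1`, and `C(t,K)·8^K ≤ C(8t,K)` trades the family size for the binomial factor. -/
theorem flatteningBoundRobust_of_bessel
    (hbessel : ∀ (t K r : ℕ) (a : Fin r → ℂ) (g : Fin r → QReg (t * 4) → ℂ), (∀ i, IsGaussian (g i)) →
      ((t.choose K * 8 ^ K : ℕ) : ℝ) - ((r * flatteningDeficiency K (t * 4) : ℕ) : ℝ)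
        ≤ ((t.choose K * 8 ^ K : ℕ) : ℝ) * normSq (magicMPow t - ∑ i, a i • g i))
    (hchoose : type_of% robust_choose_mul_eight_pow_le) :
    ∀ t K r : ℕ, r * flatteningDeficiency K (t * 4) < t.choose K * 8 ^ K →
      ∀ (a : Fin r → ℂ) (g : Fin r → QReg (t * 4) → ℂ), (∀ i, IsGaussian (g i)) →
        (1 : ℝ) ≤ ((t * 8).choose K : ℝ) * normSq (magicMPow t - ∑ i, a i • g i) := by
  intro t K r hcount a g hg
  have h := hbessel t K r a g hg
  -- the STRICT count, used exactly once
  have hd1 : ((r * flatteningDeficiency K (t * 4) : ℕ) : ℝ) + 1 ≤ ((t.choose K * 8 ^ K : ℕ) : ℝ) := by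
    exact_mod_cast hcount
  have hC : ((t.choose K * 8 ^ K : ℕ) : ℝ) ≤ ((t * 8).choose K : ℝ) := by
    exact_mod_cast hchoose t K
  have hnn : 0 ≤ normSq (magicMPow t - ∑ i, a i • g i) :=
    Finset.sum_nonneg fun _ _ => by positivity
  calc (1 : ℝ) ≤ ((t.choose K * 8 ^ K : ℕ) : ℝ) * normSq (magicMPow t - ∑ i, a i • g i) := by linarith
    _ ≤ ((t * 8).choose K : ℝ) * normSq (magicMPow t - ∑ i, a i • g i) :=
        mul_le_mul_of_nonneg_right hC hnn

/-- **The SHARP (mass-bound) form of the flattening bound**, hypothesis-free: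
`C(t,K)·8^K − r·D_K(4t) ≤ C(t,K)·8^K · normSq (M^{⊗t} − Σ aᵢ gᵢ)` for all `t K r` and Gaussian `gᵢ`
(attained at `(t,K,r) = (1,1,1)`: the Gaussian infidelity `1/2` of `|M⟩`, Disproof §C `massBound_attained_t1`). -/
theorem flatteningBoundBessel :
    ∀ (t K r : ℕ) (a : Fin r → ℂ) (g : Fin r → QReg (t * 4) → ℂ), (∀ i, IsGaussian (g i)) →
      ((t.choose K * 8 ^ K : ℕ) : ℝ) - ((r * flatteningDeficiency K (t * 4) : ℕ) : ℝ)
        ≤ ((t.choose K * 8 ^ K : ℕ) : ℝ) * normSq (magicMPow t - ∑ i, a i • g i) :=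
  flatteningBoundBessel_of_parts deficiency flatOrthonormal stub_massBound countGap_choose_mul_pow_le_card

/-- **THE CRUX, BY NAME**: `SpinorFlattening.FlatteningBoundRobust` (stmt-QuantumAdvantage-1246) — for all `t K r`
with `r·D_K(4t) < C(t,K)·8^K`, every `r`-term linear combination `φ` of Gaussian states on `4t` qubits satisfies
`1 ≤ C(8t,K) · ‖M^{⊗t} − φ‖²`.  The route's inline `maj`/`IsGauss`/`Mpow` lets are definitionally the tree's
`majorana`/`IsGaussian`/`magicMPow` (`Disproof.flatteningBoundRobust_iff : … := Iff.rfl`), so the named-API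
statement is accepted by `exact`. -/
theorem FlatteningBoundRobust_of :
    Summit.QuantumAdvantage.QuantumAdvantage.Theses.SpinorFlattening.FlatteningBoundRobust :=
  flatteningBoundRobust_of_bessel flatteningBoundBessel robust_choose_mul_eight_pow_le

/-- **Support item `SpinorFlattening.FlatteningBoundExact` (stmt-QuantumAdvantage-1249) from the crux** — the
`δ = 0` core: an exact `r`-term Gaussian decomposition would give `normSq 0 = 0`, contradicting `1 ≤ C(8t,K)·0`. -/
theorem flatteningBoundExact_of_robust
    (h : Summit.QuantumAdvantage.QuantumAdvantage.Theses.SpinorFlattening.FlatteningBoundRobust) :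
    Summit.QuantumAdvantage.QuantumAdvantage.Theses.SpinorFlattening.FlatteningBoundExact := by
  intro t K r hcount a g hg heq
  have key : (1 : ℝ) ≤ ((t * 8).choose K : ℝ) * normSq (magicMPow t - ∑ i, a i • g i) :=
    h t K r hcount a g hg
  have h0 : normSq (magicMPow t - ∑ i, a i • g i) = 0 := by
    have : magicMPow t = ∑ i, a i • g i := heq
    rw [this, sub_self]
    simp [normSq]
  rw [h0, mul_zero] at key
  exact absurd key (by norm_num)

/-- **Support item `SpinorFlattening.FlatteningBoundExact` (stmt-QuantumAdvantage-1249), outright**: under the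
count `r·D_K(4t) < C(t,K)·8^K`, `M^{⊗t}` is not an `r`-term Gaussian combination — exact Gaussian rank
`χ_G(M^{⊗t}) ≥ max_K ⌈C(t,K)8^K / D_K(4t)⌉` (≈ `1.259^t`). -/
theorem FlatteningBoundExact_of :
    Summit.QuantumAdvantage.QuantumAdvantage.Theses.SpinorFlattening.FlatteningBoundExact :=
  flatteningBoundExact_of_robust FlatteningBoundRobust_of

end Summit.QuantumAdvantage.QuantumAdvantage.Theorems.SpinorFlattening

end
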